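import Mathlib
import HarnessLib
import Summits.HubbardSuperconductivity.HubbardSuperconductivity.Theorems.KLProgrammeKLRegimeEngineFrameShiftDressingSupFlowTablesG
import Literature.MathematicalPhysics.QuantumLattice.SalmhoferCutoffGevrey
import Literature.MathematicalPhysics.QuantumLattice.SalmhoferCutoffDerivSharp
import Summits.HubbardSuperconductivity.HubbardSuperconductivity.Theorems.KLProgrammeKLRegimeEngineFrameShiftDressingSupFlowTablesGN
import Summits.HubbardSuperconductivity.HubbardSuperconductivity.Theorems.KLProgrammeKLRegimeEngineFrameShiftDressingSupFlowTablesGPure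

/-!
# K3 gen-8-FLOW (stmt 20437, stub (C), located «(B)-MAIN-UNPRIMED», cure «(B)-MAIN-PURE»): the (B) door with the cutoff tables as numerals (`B₁ = 4`) — PURE tower moments (cell gate-hubbard-kl, seat p2 g22)

Twin of `…KLProgrammeKLRegimeEngineFrameShiftDressingSupFlowTablesGN.norm_iteratedFDeriv_klLocSelfEnergyRe_flowFrame_sub_le_aliasing_gevrey_numeral4` with the ONE tower input `N` (pinned moments of `𝔉⁻¹` of the FOUR-leg kernel at the loop strings) asked in the
PURE weight `(|x̃₀|+|x̃₁|)ʲ` — zero at the local vertex for `j ≥ 1` — instead of `(1+|x̃₀|+|x̃₁|)ʲ`; every other hypothesis (two-leg rows keep the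
submultiplicative weight `(1+|x̃₀|+|x̃₁|)^·`), the conclusion and the proof are VERBATIM, the proof calling the `_pure` twin of the predecessor door.
WHY (KL STATUS 2026-08-28, p2 g22 «(B)-MAIN-UNPRIMED»): with the `(1+…)ʲ` weight the MAIN group of the general-step (B) door is `O(U²)` at every order
(the k-independent tadpole response of the bare vertex is charged in full) and its derivative rows cannot be booked against the unprimed curve-jet table
`klC4aJetC2`; with the pure weight the natural law of `N_j` is `O(U²)·(Λ_m⁻¹)ʲ` for `j ≥ 1`, so those rows are `O(U³)`.

* **`norm_iteratedFDeriv_klLocSelfEnergyRe_flowFrame_sub_le_aliasing_gevrey_numeral4_pure`**.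

Composition only; no definitions; nothing about the sizes is asserted; nothing asserts superconductivity.  References: BGM 2006 §2.3 (2.21)–(2.24), §3 (3.3)
[cite: BenfattoGiulianiMastropietro2006]; Salmhofer 1999 §4.2.5; FST 1996 §1.
-/

noncomputable section

namespace Summit.HubbardSuperconductivity.HubbardSuperconductivity.Theorems.EngineV8

set_option linter.dupNamespace false -- summit = problem name (single-conjunct summit), D-0017

open Real Finset Filter Literature.MathematicalPhysics.QuantumLattice Literature.Probability.LatticeModels GrassmannAlgebra
open Summit.HubbardSuperconductivity.HubbardSuperconductivity.Theorems.KLRegimeSplit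
open Summit.HubbardSuperconductivity.HubbardSuperconductivity.Theorems.TwoVolumeDefect
open Summit.HubbardSuperconductivity.HubbardSuperconductivity.Theorems.KLProgrammeLegKernels
open Summit.HubbardSuperconductivity.HubbardSuperconductivity.Theorems.DispersionFlow
open scoped Nat

variable {L M : ℕ} [NeZero L] [NeZero M]

section Flow

variable {β : ℝ} (hβ : 0 < β) (U μ : ℝ) (m : ℕ)
include hβ

/-- **THE CORRECTED (B) DOOR AT THE FLOW FRAMES WITH THE CUTOFF TABLES AS NUMERALS — SHARP LIPSCHITZ CONSTANT `B₁ = 4`**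
(`SalmhoferCutoffDerivSharp.abs_deriv_salmhoferCutoff_le_four`; `X₄ = 8·576·342⁴`, `X₀ = 8`, `C_χ = 342` as above): the same door with the MAIN term's cutoff factor
`200 + 200·4 = 1000` instead of `547 400` — the form the (P) closer should use (seat p2 g15 append). [cite: BenfattoGiulianiMastropietro2006, §2.3 (2.21)–(2.24)] -/
theorem norm_iteratedFDeriv_klLocSelfEnergyRe_flowFrame_sub_le_aliasing_gevrey_numeral4_pure
    {G : GeoConsts} {Q : EngConsts} {R : RenConsts} (hRG : ∀ j, 0 ≤ R.Gfr j) (hGS : ∀ k, 0 ≤ G.S k) (hQS : ∀ k, 0 ≤ Q.S' k) (hμ : μ ∈ klWindowC)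
    {Nf₁ Nf₂ : ℕ} (hOK₁ : FrameOK R U Nf₁ μ (klFlowFrameU L M β U μ m)) (hOK₂ : FrameOK R U Nf₂ μ (klFlowFrameU L M β U μ (m + 1)))
    {fd : ℝ} (hfdist : frameDist (klFlowFrameU L M β U μ (m + 1)) (klFlowFrameU L M β U μ m) ≤ fd) (hfd : fd ≤ (klScale klE0 m) / 4)
    (hZ₂ : IsUnit (effPartitionFn ℂ (normalCovariance L M (uvSymbolCT L M β μ (klFlowFrameU L M β U μ (m + 1)) (klScale klE0 m))) (hubbardInteraction L M β U + counterQuadratic L M β (klFlowFrameU L M β U μ (m + 1)))))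
    (hZ : ∀ t ∈ Set.Icc (0 : ℝ) 1, effPartitionFn ℂ
      (normalCovariance L M (uvSymbolCT L M β μ (klFlowFrameU L M β U μ m) (klScale klE0 m)) + ((t : ℂ)) • (normalCovariance L M (fun ks => uvSymbolCT L M β μ (klFlowFrameU L M β U μ (m + 1)) (klScale klE0 m) ks / (1 + uvSymbolCT L M β μ (klFlowFrameU L M β U μ (m + 1)) (klScale klE0 m) ks * (((fsub (klFlowFrameU L M β U μ (m + 1)) (klFlowFrameU L M β U μ m)).eval (latticeMomentum L ks.1.2) / (β * (L : ℝ) ^ 2) : ℝ) : ℂ))) - normalCovariance L M (uvSymbolCT L M β μ (klFlowFrameU L M β U μ m) (klScale klE0 m)))) (hubbardInteraction L M β U + counterQuadratic L M β (klFlowFrameU L M β U μ m)) ≠ 0)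
    (j : ℕ) (q : Momentum) {N : ℝ} (hN0 : 0 ≤ N)
    (hN : ∀ t ∈ Set.Icc (0 : ℝ) 1, ∀ i ∈ ({omega0 M, (omega0 M).rev} : Finset (MatsubaraIdx M)), ∀ σ : Fin 2, ∀ Al : HubbardFieldIdx L M,
      |matsubaraFreq β M Al.1.1.1| < (klScale klE0 m) →
      (|nambuXiCT L μ (klFlowFrameU L M β U μ m) Al.1.1.2| < (klScale klE0 m) ∨ |nambuXiCT L μ (klFlowFrameU L M β U μ (m + 1)) Al.1.1.2| < (klScale klE0 m)) →
      ∑ x : TorusSite 2 L, (((x 0).valMinAbs.natAbs : ℝ) + ((x 1).valMinAbs.natAbs : ℝ)) ^ j * ‖torusFourierInv (fun kv : TorusSite 2 L =>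
        kernel ℂ (effAction ℂ (normalCovariance L M (uvSymbolCT L M β μ (klFlowFrameU L M β U μ m) (klScale klE0 m)) + ((t : ℂ)) • (normalCovariance L M (fun ks => uvSymbolCT L M β μ (klFlowFrameU L M β U μ (m + 1)) (klScale klE0 m) ks / (1 + uvSymbolCT L M β μ (klFlowFrameU L M β U μ (m + 1)) (klScale klE0 m) ks * (((fsub (klFlowFrameU L M β U μ (m + 1)) (klFlowFrameU L M β U μ m)).eval (latticeMomentum L ks.1.2) / (β * (L : ℝ) ^ 2) : ℝ) : ℂ))) - normalCovariance L M (uvSymbolCT L M β μ (klFlowFrameU L M β U μ m) (klScale klE0 m)))) (hubbardInteraction L M β U + counterQuadratic L M β (klFlowFrameU L M β U μ m))) 4 (Fin.snoc (Fin.snoc ![((((i, kv), σ), 0) : HubbardFieldIdx L M), (((i, kv), σ), 1)] (Al.1, 1 - Al.2) : Fin 3 → HubbardFieldIdx L M) Al)) x‖ ≤ N)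
    (hq₂ : (Real.pi / β) ^ 2 + frameLevel μ (klFlowFrameU L M β U μ (m + 1)) q ^ 2 < (klScale klE0 m) ^ 2 / 4) (hq₁ : (Real.pi / β) ^ 2 + frameLevel μ (klFlowFrameU L M β U μ m) q ^ 2 < (klScale klE0 m) ^ 2 / 4)
    {Md s : ℕ} (hM : 4 + j ≤ Md) {Sj Ss Sj' Ss' : ℝ}
    (hRmom : ∀ t ∈ Set.Icc (0 : ℝ) 1, ∀ i ∈ ({omega0 M, (omega0 M).rev} : Finset (MatsubaraIdx M)), ∀ σ : Fin 2,
      (∑ x : TorusSite 2 L, (1 + ((x 0).valMinAbs.natAbs : ℝ) + ((x 1).valMinAbs.natAbs : ℝ)) ^ j * ‖torusFourierInv (fun kv : TorusSite 2 L =>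
        kernel ℂ (effAction ℂ (normalCovariance L M (uvSymbolCT L M β μ (klFlowFrameU L M β U μ m) (klScale klE0 m)) + ((t : ℂ)) • (normalCovariance L M (fun ks => uvSymbolCT L M β μ (klFlowFrameU L M β U μ (m + 1)) (klScale klE0 m) ks / (1 + uvSymbolCT L M β μ (klFlowFrameU L M β U μ (m + 1)) (klScale klE0 m) ks * (((fsub (klFlowFrameU L M β U μ (m + 1)) (klFlowFrameU L M β U μ m)).eval (latticeMomentum L ks.1.2) / (β * (L : ℝ) ^ 2) : ℝ) : ℂ))) - normalCovariance L M (uvSymbolCT L M β μ (klFlowFrameU L M β U μ m) (klScale klE0 m)))) (hubbardInteraction L M β U + counterQuadratic L M β (klFlowFrameU L M β U μ m))) 2 ![((((i, kv), σ), 0) : HubbardFieldIdx L M), (((i, kv), σ), 1)]) x‖ ≤ Sj) ∧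
      (∑ x : TorusSite 2 L, (1 + ((x 0).valMinAbs.natAbs : ℝ) + ((x 1).valMinAbs.natAbs : ℝ)) ^ s * ‖torusFourierInv (fun kv : TorusSite 2 L =>
        kernel ℂ (effAction ℂ (normalCovariance L M (uvSymbolCT L M β μ (klFlowFrameU L M β U μ m) (klScale klE0 m)) + ((t : ℂ)) • (normalCovariance L M (fun ks => uvSymbolCT L M β μ (klFlowFrameU L M β U μ (m + 1)) (klScale klE0 m) ks / (1 + uvSymbolCT L M β μ (klFlowFrameU L M β U μ (m + 1)) (klScale klE0 m) ks * (((fsub (klFlowFrameU L M β U μ (m + 1)) (klFlowFrameU L M β U μ m)).eval (latticeMomentum L ks.1.2) / (β * (L : ℝ) ^ 2) : ℝ) : ℂ))) - normalCovariance L M (uvSymbolCT L M β μ (klFlowFrameU L M β U μ m) (klScale klE0 m)))) (hubbardInteraction L M β U + counterQuadratic L M β (klFlowFrameU L M β U μ m))) 2 ![((((i, kv), σ), 0) : HubbardFieldIdx L M), (((i, kv), σ), 1)]) x‖ ≤ Ss))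
    (hSE : ∀ i ∈ ({omega0 M, (omega0 M).rev} : Finset (MatsubaraIdx M)), ∀ σ : Fin 2,
      (∑ x : TorusSite 2 L, (1 + ((x 0).valMinAbs.natAbs : ℝ) + ((x 1).valMinAbs.natAbs : ℝ)) ^ j * ‖torusFourierInv (fun kv : TorusSite 2 L =>
        selfEnergy L M β (effAction ℂ (normalCovariance L M (fun ks => uvSymbolCT L M β μ (klFlowFrameU L M β U μ (m + 1)) (klScale klE0 m) ks / (1 + uvSymbolCT L M β μ (klFlowFrameU L M β U μ (m + 1)) (klScale klE0 m) ks * (((fsub (klFlowFrameU L M β U μ (m + 1)) (klFlowFrameU L M β U μ m)).eval (latticeMomentum L ks.1.2) / (β * (L : ℝ) ^ 2) : ℝ) : ℂ)))) (hubbardInteraction L M β U + counterQuadratic L M β (klFlowFrameU L M β U μ m))) (i, kv) σ) x‖ ≤ Sj') ∧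
      (∑ x : TorusSite 2 L, (1 + ((x 0).valMinAbs.natAbs : ℝ) + ((x 1).valMinAbs.natAbs : ℝ)) ^ s * ‖torusFourierInv (fun kv : TorusSite 2 L =>
        selfEnergy L M β (effAction ℂ (normalCovariance L M (fun ks => uvSymbolCT L M β μ (klFlowFrameU L M β U μ (m + 1)) (klScale klE0 m) ks / (1 + uvSymbolCT L M β μ (klFlowFrameU L M β U μ (m + 1)) (klScale klE0 m) ks * (((fsub (klFlowFrameU L M β U μ (m + 1)) (klFlowFrameU L M β U μ m)).eval (latticeMomentum L ks.1.2) / (β * (L : ℝ) ^ 2) : ℝ) : ℂ)))) (hubbardInteraction L M β U + counterQuadratic L M β (klFlowFrameU L M β U μ m))) (i, kv) σ) x‖ ≤ Ss'))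
    -- the flow history and the envelope parameters (the cutoff tables are now numerals)
    {n : ℕ} (hP : ∀ m' ≤ n, FlowPieceJetsAt L M β U μ R m') (hTJ : ∀ m' ≤ n, TwoLegReadJetsF L M G Q β U μ m') (hmn : m ≤ n)
    {Ξ Θ Φ : ℝ} (hΞ0 : 0 ≤ Ξ) (hΘ0 : 0 ≤ Θ) (hΦ0 : 0 ≤ Φ) (hΞ : ∀ i, 1 ≤ i → (if i ≤ 4 then R.Gfr i * uPow i U
      else 2 ^ i * (Real.pi ^ 8 / 4 * 2 ^ (i - 1) * (2 : ℝ) ^ (8 * (i - 1))) *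
        ((curveExtC (8 * 576 * (342 : ℝ) ^ 4) G.S 1 + curveExtC (8 * 576 * (342 : ℝ) ^ 4) Q.S' 1 * |U|) * U ^ 2)) ≤ i ! * Ξ ^ i)
    (hΘΦ : ∀ i : ℕ, (if i ≤ 4 then R.Gfr i * uPow i U
      else 2 ^ i * (Real.pi ^ 8 / 4 * 2 ^ (i - 1) * (2 : ℝ) ^ (8 * (i - 1))) *
        ((curveExtC (8 * 576 * (342 : ℝ) ^ 4) G.S 1 + curveExtC (8 * 576 * (342 : ℝ) ^ 4) Q.S' 1 * |U|) * U ^ 2)) ≤ R.Gfr 0 * |U| * Θ * i ! * (2 ^ 10 * Φ) ^ i)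
    (hδΛ : (R.Gfr 0 * |U| * Θ * ((16 : ℝ) ^ m)⁻¹) ≤ (klScale klE0 m) / 4) :
    ‖iteratedFDeriv ℝ j (evalM (symInterp L (fun kv : TorusSite 2 L =>
        klLocSelfEnergyRe L M β U μ (klFlowFrameU L M β U μ (m + 1)) m kv - klLocSelfEnergyRe L M β U μ (klFlowFrameU L M β U μ m) m kv - (fsub (klFlowFrameU L M β U μ (m + 1)) (klFlowFrameU L M β U μ m)).eval (latticeMomentum L kv)))) q‖ ≤
      2 * (2 * (|β| * (L : ℝ) ^ 2) * (12 * (2 * ((klScale klE0 m) * β / Real.pi + 3) *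
        ((1793 * (klScale klE0 m) * (L : ℝ) ^ 2 + 704 * L) + (1793 * (klScale klE0 m) * (L : ℝ) ^ 2 + 704 * L)) *
        (β * (L : ℝ) ^ 2 * (200 + 200 * 4) / (klScale klE0 m) ^ 2 * fd)) * N)) +
      (4 * (2 * (2 * ((2 * |β| * (L : ℝ) ^ 2 * Sj ^ 2) * ((3 : ℝ) ^ j * (8 * (|(β * (L : ℝ) ^ 2)| * (6 / (klScale klE0 m))) * ((Md ! : ℝ)) ^ 2 * (2 * (4 * (2 * (4 * (4 + (4 : ℝ) ^ m * Ξ) * (1 + 16 * (1 + 342) / (klScale klE0 m) * 1) + (2 ^ 10 * Φ * (4 : ℝ) ^ m))) * (1 + 6 / (klScale klE0 m) * ((klScale klE0 m) / 128 + 8 * (R.Gfr 0 * |U| * Θ * ((16 : ℝ) ^ m)⁻¹))))) ^ Md +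
        8 * (|(β * (L : ℝ) ^ 2)| * (2 / (klScale klE0 m))) * ((Md ! : ℝ)) ^ 2 * (4 * ((4 + (4 : ℝ) ^ m * Ξ) + (2 ^ 10 * Φ * (4 : ℝ) ^ m)) * (1 + 2 * (16 * (1 + 342) / (klScale klE0 m)) * (1 + (R.Gfr 0 * |U| * Θ * ((16 : ℝ) ^ m)⁻¹)))) ^ Md) * (2 / ((2 * (L / 4 + 1) : ℕ) : ℝ)) ^ (Md - j - 4) * (2 ^ 2 * ∑' k : Fin 2 → ℤ, ∏ c, (1 + (k c : ℝ) ^ 2)⁻¹)))) + (L : ℝ) ^ 2 * (L : ℝ) ^ j * ((8 * (|(β * (L : ℝ) ^ 2)| * (6 / (klScale klE0 m))) * ((0 ! : ℝ)) ^ 2 * (2 * (4 * (2 * (4 * (4 + (4 : ℝ) ^ m * Ξ) * (1 + 16 * (1 + 342) / (klScale klE0 m) * 1) + (2 ^ 10 * Φ * (4 : ℝ) ^ m))) * (1 + 6 / (klScale klE0 m) * ((klScale klE0 m) / 128 + 8 * (R.Gfr 0 * |U| * Θ * ((16 : ℝ) ^ m)⁻¹))))) ^ 0 +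
        8 * (|(β * (L : ℝ) ^ 2)| * (2 / (klScale klE0 m))) * ((0 ! : ℝ)) ^ 2 * (4 * ((4 + (4 : ℝ) ^ m * Ξ) + (2 ^ 10 * Φ * (4 : ℝ) ^ m)) * (1 + 2 * (16 * (1 + 342) / (klScale klE0 m)) * (1 + (R.Gfr 0 * |U| * Θ * ((16 : ℝ) ^ m)⁻¹)))) ^ 0) * ((2 * |β| * (L : ℝ) ^ 2 * Ss ^ 2) / (1 + (L : ℝ) / 4) ^ s)))) + (2 * (2 : ℕ) * ((2 * (2 * ((1 / 4 : ℝ) * ((3 : ℝ) ^ j * (((R.Gfr 0 * |U| * Θ * ((16 : ℝ) ^ m)⁻¹) * (R.Gfr 0 * |U| * Θ * ((16 : ℝ) ^ m)⁻¹) / |(β * (L : ℝ) ^ 2)|) * (8 * (|(β * (L : ℝ) ^ 2)| * (6 / (klScale klE0 m)))) * ((Md ! : ℝ)) ^ 2 * (2 * (2 * (2 ^ 10 * Φ * (4 : ℝ) ^ m) + 2 * (4 * (2 * (4 * (4 + (4 : ℝ) ^ m * Ξ) * (1 + 16 * (1 + 342) / (klScale klE0 m) * 1) + (2 ^ 10 *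 Φ * (4 : ℝ) ^ m))) * (1 + 6 / (klScale klE0 m) * ((klScale klE0 m) / 128 + 8 * (R.Gfr 0 * |U| * Θ * ((16 : ℝ) ^ m)⁻¹)))))) ^ Md) * (2 / ((2 * (L / 4 + 1) : ℕ) : ℝ)) ^ (Md - j - 4) * (2 ^ 2 * ∑' k : Fin 2 → ℤ, ∏ c, (1 + (k c : ℝ) ^ 2)⁻¹)))) + (L : ℝ) ^ 2 * (L : ℝ) ^ j * ((((R.Gfr 0 * |U| * Θ * ((16 : ℝ) ^ m)⁻¹) * (R.Gfr 0 * |U| * Θ * ((16 : ℝ) ^ m)⁻¹) / |(β * (L : ℝ) ^ 2)|) * (8 * (|(β * (L : ℝ) ^ 2)| * (6 / (klScale klE0 m)))) * ((0 ! : ℝ)) ^ 2 * (2 * (2 * (2 ^ 10 * Φ * (4 : ℝ) ^ m) + 2 * (4 * (2 * (4 * (4 + (4 : ℝ) ^ m * Ξ) * (1 + 16 * (1 + 342) / (klScale klE0 m) * 1) + (2 ^ 10 * Φ * (4 : ℝ) ^ m))) * (1 + 6 / (klScale klE0 m) * ((klScale klE0 m) / 128 + 8 * (R.Gfr 0 *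 |U| * Θ * ((16 : ℝ) ^ m)⁻¹)))))) ^ 0) * ((1 / 4 : ℝ) / (1 + (L : ℝ) / 4) ^ s))) + (2 * (2 * ((1 / 4 * Sj') * ((3 : ℝ) ^ j * (((R.Gfr 0 * |U| * Θ * ((16 : ℝ) ^ m)⁻¹) / |(β * (L : ℝ) ^ 2)| * (8 * (|(β * (L : ℝ) ^ 2)| * (6 / (klScale klE0 m))))) * ((R.Gfr 0 * |U| * Θ * ((16 : ℝ) ^ m)⁻¹) / |(β * (L : ℝ) ^ 2)| * (8 * (|(β * (L : ℝ) ^ 2)| * (6 / (klScale klE0 m))))) * ((Md ! : ℝ)) ^ 2 * (2 * (2 * (2 * (2 ^ 10 * Φ * (4 : ℝ) ^ m) + 2 * (4 * (2 * (4 * (4 + (4 : ℝ) ^ m * Ξ) * (1 + 16 * (1 + 342) / (klScale klE0 m) * 1) + (2 ^ 10 * Φ * (4 : ℝ) ^ m))) * (1 + 6 / (klScale klE0 m) * ((klScale klE0 m) / 128 + 8 * (R.Gfr 0 * |U| * Θ * ((16 : ℝ) ^ m)⁻¹))))))) ^ Md + 2 * (((R.Gfr 0 * |U| * Θ * ((16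 : ℝ) ^ m)⁻¹) / |(β * (L : ℝ) ^ 2)|) * (8 * (|(β * (L : ℝ) ^ 2)| * (6 / (klScale klE0 m)))) * ((Md ! : ℝ)) ^ 2 * (2 * (2 * (2 ^ 10 * Φ * (4 : ℝ) ^ m) + 2 * (4 * (2 * (4 * (4 + (4 : ℝ) ^ m * Ξ) * (1 + 16 * (1 + 342) / (klScale klE0 m) * 1) + (2 ^ 10 * Φ * (4 : ℝ) ^ m))) * (1 + 6 / (klScale klE0 m) * ((klScale klE0 m) / 128 + 8 * (R.Gfr 0 * |U| * Θ * ((16 : ℝ) ^ m)⁻¹)))))) ^ Md)) * (2 / ((2 * (L / 4 + 1) : ℕ) : ℝ)) ^ (Md - j - 4) * (2 ^ 2 * ∑' k : Fin 2 → ℤ, ∏ c, (1 + (k c : ℝ) ^ 2)⁻¹)))) + (L : ℝ) ^ 2 * (L : ℝ) ^ j * ((((R.Gfr 0 * |U| * Θ * ((16 : ℝ) ^ m)⁻¹) / |(β * (L : ℝ) ^ 2)| * (8 * (|(β * (L : ℝ) ^ 2)| * (6 / (klScale klE0 m))))) * ((R.Gfr 0 * |U| * Θ * ((16 : ℝ)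 ^ m)⁻¹) / |(β * (L : ℝ) ^ 2)| * (8 * (|(β * (L : ℝ) ^ 2)| * (6 / (klScale klE0 m))))) * ((0 ! : ℝ)) ^ 2 * (2 * (2 * (2 * (2 ^ 10 * Φ * (4 : ℝ) ^ m) + 2 * (4 * (2 * (4 * (4 + (4 : ℝ) ^ m * Ξ) * (1 + 16 * (1 + 342) / (klScale klE0 m) * 1) + (2 ^ 10 * Φ * (4 : ℝ) ^ m))) * (1 + 6 / (klScale klE0 m) * ((klScale klE0 m) / 128 + 8 * (R.Gfr 0 * |U| * Θ * ((16 : ℝ) ^ m)⁻¹))))))) ^ 0 + 2 * (((R.Gfr 0 * |U| * Θ * ((16 : ℝ) ^ m)⁻¹) / |(β * (L : ℝ) ^ 2)|) * (8 * (|(β * (L : ℝ) ^ 2)| * (6 / (klScale klE0 m)))) * ((0 ! : ℝ)) ^ 2 * (2 * (2 * (2 ^ 10 * Φ * (4 : ℝ) ^ m) + 2 * (4 * (2 * (4 * (4 + (4 : ℝ) ^ m * Ξ) * (1 + 16 * (1 + 342) / (klScale klE0 m) * 1) + (2 ^ 10 * Φ * (4 : ℝ) ^ m))) * (1 + 6 /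 (klScale klE0 m) * ((klScale klE0 m) / 128 + 8 * (R.Gfr 0 * |U| * Θ * ((16 : ℝ) ^ m)⁻¹)))))) ^ 0)) * ((1 / 4 * Ss') / (1 + (L : ℝ) / 4) ^ s))))) :=
  norm_iteratedFDeriv_klLocSelfEnergyRe_flowFrame_sub_le_aliasing_gevrey_pure hβ U μ m hRG hGS hQS hμ hOK₁ hOK₂ (by norm_num)
    abs_deriv_salmhoferCutoff_le_four hfdist hfd hZ₂ hZ j q hN0 hN hq₂ hq₁ hM hRmom hSE salmhoferCutoff_flat_table_four
    (by norm_num) (by norm_num) (salmhoferCutoff_gevrey_table Md) hP hTJ hmn hΞ0 hΘ0 hΦ0 hΞ hΘΦ hδΛ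

end Flow

end Summit.HubbardSuperconductivity.HubbardSuperconductivity.Theorems.EngineV8

end
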